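import Summits.AnomalousDissipation.AnomalousDissipation.Theorems.SolenoidalFractalHomogenisationLagrangianStepClosedWindow
import Summits.AnomalousDissipation.AnomalousDissipation.Theorems.SolenoidalFractalHomogenisationLagrangianStepFrameConjugatePropagator
import HarnessLib

/-!
# K1L_D (stmt-AnomalousDissipation-27980), `stub_Z7_alphaBeta` α-provider, (T1) sub-target (C3) of memos L15/L16: the TIME DERIVATIVE of an
# Eulerian test read in the moving frame (helper; `--supports … --as helper`; lead-k1l-onelevel-p1 g5)

For the (T1) transfer (frame ⇒ Eulerian for weak solutions, memo L16 §3) an Eulerian space–time test `Φ` is read in the frame of the coarse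
flow started at the reset `s`: `Ψ τ y := Φ τ (X m (t₀ + κτ) s y)`.  Since `disp m · s y` is the time integral of the continuous
`r ↦ b_{≤m}(r, X m r s y)` (`IsFlow`, all times) it is differentiable in time with derivative `b_{≤m}(t′, X m t′ s y)` (§1,
`hasDerivAt_disp`), and the chain rule through the smooth space–time lift of `Φ` gives (§2, **`hasDerivAt_test_comp_flow`**)
`∂_τ [Φ τ (X m (t₀+κτ) s y)] = (∂_t Φ) τ (X y) + κ • ((b_{≤m}(t₀+κτ) · ∇) (Φ τ)) (X y)`,
i.e. `timeDeriv Ψ τ y = timeDeriv Φ τ (X y) + κ • convect (partialSum m (t₀+κτ)) (Φ τ) (X y)` — the Eulerian coarse transport term appears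
from the motion of the frame.  NOT a proof of the stub, of the crux, or of AD; rung F-D1.A0.
-/

set_option linter.dupNamespace false  -- the summit-side namespace `Summit.AnomalousDissipation.AnomalousDissipation.…` repeats a component by design (D-0017)

noncomputable section

namespace Summit.AnomalousDissipation.AnomalousDissipation.Theorems.SolenoidalFractalHomogenisation.LagrangianStep.FrameConj

open Set Function Filter MeasureTheory Topology
open Literature.Analysis Literature.Analysis.FunctionSpaces Literature.Analysis.FunctionSpaces.Torus
open Literature.Analysis.FluidPDE Literature.Analysis.FluidPDE.LatticeShear
open Literature.Analysis.FluidPDE.LatticeShear (LagrangianLatticeCarrier)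

variable {k : ℕ}

/-! ## §1 The flow is differentiable in time (FTC on `IsFlow`) -/

/-- `r ↦ b_{≤m}(r, X m r s y)` is continuous (joint continuity of `partialSum` and of the flow). -/
theorem continuous_partialSum_comp_X (E : LagrangianLatticeCarrier k) (hR : E.LevelRegular) (m : ℕ) (s : ℝ) (y : UnitAddTorus (Fin 3)) :
    Continuous fun r => E.partialSum m r (E.X m r s y) :=
  (hR.continuous_uncurry_partialSum m).comp
    (continuous_id.prodMk ((continuous_X_uncurry E hR m s).comp (continuous_id.prodMk continuous_const)))

/-- **FTC for the flow**: `t′ ↦ disp m t′ s y` has derivative `b_{≤m}(t′, X m t′ s y)` at every `t′` (`IsFlow`: the displacement is the time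
integral of the continuous integrand `r ↦ b_{≤m}(r, X m r s y)`). -/
theorem hasDerivAt_disp (E : LagrangianLatticeCarrier k) (hR : E.LevelRegular) {m : ℕ} (hF : E.IsFlow m) (s t' : ℝ)
    (y : UnitAddTorus (Fin 3)) :
    HasDerivAt (fun t'' => E.disp m t'' s y) (E.partialSum m t' (E.X m t' s y)) t' := by
  have heq : (fun t'' => E.disp m t'' s y) = fun t'' => ∫ r in s..t'', E.partialSum m r (E.X m r s y) :=
    funext fun t'' => hF t'' s y
  rw [heq]
  exact ((continuous_partialSum_comp_X E hR m s y).integral_hasStrictDerivAt s t').hasDerivAt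

/-- Along the affine clock `τ ↦ t₀ + κτ`: `∂_τ disp m (t₀+κτ) s y = κ • b_{≤m}(t₀+κτ, X y)`. -/
theorem hasDerivAt_disp_affine (E : LagrangianLatticeCarrier k) (hR : E.LevelRegular) {m : ℕ} (hF : E.IsFlow m) (s t₀ κ τ : ℝ)
    (y : UnitAddTorus (Fin 3)) :
    HasDerivAt (fun τ' => E.disp m (t₀ + κ * τ') s y) (κ • E.partialSum m (t₀ + κ * τ) (E.X m (t₀ + κ * τ) s y)) τ := by
  have hclock : HasDerivAt (fun τ' : ℝ => t₀ + κ * τ') κ τ := by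
    simpa using ((hasDerivAt_id τ).const_mul κ).const_add t₀
  exact (hasDerivAt_disp E hR hF s (t₀ + κ * τ) y).scomp τ hclock

/-! ## §2 The chain rule through the space–time lift of the test -/

section Test

variable {F : Type*} [NormedAddCommGroup F] [NormedSpace ℝ F]

/-- The partial derivative of a `C¹` space–time lift in the time direction is the time derivative of the field. -/
theorem fderiv_stLift_inl {Φ : ℝ → UnitAddTorus (Fin 3) → F} (hΦ : ContDiff ℝ 1 (stLift Φ)) (τ : ℝ) (v : EuclideanSpace ℝ (Fin 3)) :
    fderiv ℝ (stLift Φ) (τ, v) ((1 : ℝ), (0 : EuclideanSpace ℝ (Fin 3))) = Torus.timeDeriv Φ τ (proj v) := by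
  have hG : HasFDerivAt (stLift Φ) (fderiv ℝ (stLift Φ) (τ, v)) (τ, v) :=
    (hΦ.differentiable (by norm_num) _).hasFDerivAt
  have hcurve : HasDerivAt (fun τ' : ℝ => ((τ', v) : ℝ × EuclideanSpace ℝ (Fin 3))) ((1 : ℝ), (0 : EuclideanSpace ℝ (Fin 3))) τ :=
    (hasDerivAt_id τ).prodMk (hasDerivAt_const τ v)
  have h := (hG.comp_hasDerivAt τ hcurve).deriv
  rw [Torus.timeDeriv]
  exact h.symm

/-- The partial derivative of a `C¹` space–time lift in a space direction is the torus derivative of the slice. -/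
theorem fderiv_stLift_inr {Φ : ℝ → UnitAddTorus (Fin 3) → F} (hΦ : ContDiff ℝ 1 (stLift Φ)) (τ : ℝ) (v w : EuclideanSpace ℝ (Fin 3)) :
    fderiv ℝ (stLift Φ) (τ, v) ((0 : ℝ), w) = Torus.fderiv (Φ τ) (proj v) w := by
  have hG : HasFDerivAt (stLift Φ) (fderiv ℝ (stLift Φ) (τ, v)) (τ, v) :=
    (hΦ.differentiable (by norm_num) _).hasFDerivAt
  have hsl : HasFDerivAt (fun v' : EuclideanSpace ℝ (Fin 3) => ((τ, v') : ℝ × EuclideanSpace ℝ (Fin 3)))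
      (ContinuousLinearMap.inr ℝ ℝ (EuclideanSpace ℝ (Fin 3))) v := hasFDerivAt_prodMk_right τ v
  have h := hG.comp v hsl
  have hlift : (stLift Φ ∘ fun v' : EuclideanSpace ℝ (Fin 3) => ((τ, v') : ℝ × EuclideanSpace ℝ (Fin 3))) = lift (Φ τ) := by
    funext v'; rfl
  rw [hlift] at h
  rw [← fderiv_lift, h.fderiv, ContinuousLinearMap.comp_apply, ContinuousLinearMap.inr_apply]

/-- **(C3) The time derivative of an Eulerian test read in the moving frame.**  For `Φ` with `C¹` space–time lift, an `IsFlow` level `m`,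
reset `s`, and the affine clock `t′ = t₀ + κτ`:
`∂_τ [Φ τ (X m (t₀+κτ) s y)] = timeDeriv Φ τ (X y) + κ • convect (partialSum m (t₀+κτ)) (Φ τ) (X y)`, `X y = X m (t₀+κτ) s y`. -/
theorem hasDerivAt_test_comp_flow (E : LagrangianLatticeCarrier k) (hR : E.LevelRegular) {m : ℕ} (hF : E.IsFlow m) (s t₀ κ : ℝ)
    {Φ : ℝ → UnitAddTorus (Fin 3) → F} (hΦ : ContDiff ℝ 1 (stLift Φ)) (τ : ℝ) (y : UnitAddTorus (Fin 3)) :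
    HasDerivAt (fun τ' => Φ τ' (E.X m (t₀ + κ * τ') s y))
      (Torus.timeDeriv Φ τ (E.X m (t₀ + κ * τ) s y) +
        κ • convect (E.partialSum m (t₀ + κ * τ)) (Φ τ) (E.X m (t₀ + κ * τ) s y)) τ := by
  -- the lifted curve `γ τ' = (τ', repr y + disp m (t₀+κτ') s y)` and `stLift Φ ∘ γ = the composite`
  set γ : ℝ → ℝ × EuclideanSpace ℝ (Fin 3) := fun τ' => (τ', repr y + E.disp m (t₀ + κ * τ') s y) with hγ
  have hcomp : (fun τ' => Φ τ' (E.X m (t₀ + κ * τ') s y)) = stLift Φ ∘ γ := by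
    funext τ'
    simp only [hγ, comp_apply, stLift_apply, proj_add, proj_repr]
    rfl
  have hγ' : HasDerivAt γ ((1 : ℝ), κ • E.partialSum m (t₀ + κ * τ) (E.X m (t₀ + κ * τ) s y)) τ :=
    (hasDerivAt_id τ).prodMk ((hasDerivAt_disp_affine E hR hF s t₀ κ τ y).const_add (repr y))
  have hG : HasFDerivAt (stLift Φ) (fderiv ℝ (stLift Φ) (γ τ)) (γ τ) := (hΦ.differentiable (by norm_num) _).hasFDerivAt
  have h := hG.comp_hasDerivAt τ hγ'
  rw [hcomp]
  convert h using 1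
  -- split the direction `(1, κ•b) = (1, 0) + κ • (0, b)` and read the two partial derivatives
  have hsplit : (((1 : ℝ), κ • E.partialSum m (t₀ + κ * τ) (E.X m (t₀ + κ * τ) s y)) : ℝ × EuclideanSpace ℝ (Fin 3))
      = ((1 : ℝ), (0 : EuclideanSpace ℝ (Fin 3))) + κ • ((0 : ℝ), E.partialSum m (t₀ + κ * τ) (E.X m (t₀ + κ * τ) s y)) := by
    ext <;> simp
  have hproj : proj (repr y + E.disp m (t₀ + κ * τ) s y) = E.X m (t₀ + κ * τ) s y := by
    rw [proj_add, proj_repr]; rfl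
  rw [hsplit, map_add, map_smul, show γ τ = (τ, repr y + E.disp m (t₀ + κ * τ) s y) from rfl, fderiv_stLift_inl hΦ,
    fderiv_stLift_inr hΦ, hproj]
  rfl

end Test

end Summit.AnomalousDissipation.AnomalousDissipation.Theorems.SolenoidalFractalHomogenisation.LagrangianStep.FrameConj

end
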